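import Summits.NavierStokesRegularity.FunctionalMining.CrossedShearProfiles
import Mathlib.Analysis.Fourier.AddCircle
import HarnessLib

/-!
# FunctionalMining — the sharp Wirtinger inequality for smooth `1`-periodic profiles (tool file)

Search for candidate a priori estimates; no regularity claim. Cell `pub-nsfunc`, prove seat
(gen 19). TOOL FILE: the classical sharp Wirtinger (Poincaré) inequality on the unit circle for the
tree's smooth periodic profiles (`ShearProfile`), which the tree so far only had with non-sharp
constants (`Literature…TorusPoincareMorrey`: `‖f − ∫f‖_p ≤ d‖Df‖_p`):

* `ProfileWirtinger.wirtinger` — for a smooth `1`-periodic `P : ℝ → ℝ` with `∫₀¹ P = 0`,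
  **`4π² ∫₀¹ P² ≤ ∫₀¹ (P′)²`**;
* `ProfileWirtinger.wirtinger_D` — hence for EVERY smooth `1`-periodic `F`, `4π² ∫₀¹ (F′)² ≤ ∫₀¹ (F″)²`
  (`F′` has zero mean).

Proof: Parseval on `(0, 1]` (Mathlib `hasSum_sq_fourierCoeffOn`) for `P` and for `P′`, the coefficient
relation `P̂′(n) = 2πi n · P̂(n)` (Mathlib `fourierCoeffOn_of_hasDerivAt`, the boundary term vanishing by
periodicity), `P̂(0) = ∫₀¹ P = 0`, and `n² ≥ 1` termwise (`hasSum_le`). Used by `TopEigLaminateTwo`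
(laminates are rigid for Lemma L-λ(2)). [folklore: W. Wirtinger, in Blaschke, *Kreis und Kugel* (1916) §21;
Hardy–Littlewood–Pólya, *Inequalities*, Thm. 258]
-/

noncomputable section

open MeasureTheory Set Complex intervalIntegral

namespace Summit.NavierStokesRegularity.FunctionalMining

open Literature.Analysis.FunctionSpaces Literature.Analysis.FunctionSpaces.Torus

namespace ProfileWirtinger

open Real in
/-- **Sharp Wirtinger inequality on the unit circle**: a smooth `1`-periodic profile with zero mean has
`4π² ∫₀¹ P² ≤ ∫₀¹ (P′)²`. [folklore: Wirtinger 1916; Hardy–Littlewood–Pólya Thm. 258] -/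
theorem wirtinger (P : ShearProfile) (h0 : ∫ t in (0 : ℝ)..1, P t = 0) :
    4 * π ^ 2 * ∫ t in (0 : ℝ)..1, P t ^ 2 ≤ ∫ t in (0 : ℝ)..1, P.D t ^ 2 := by
  have h01 : (0 : ℝ) < 1 := one_pos
  set G : ℝ → ℂ := fun t => ((P t : ℝ) : ℂ) with hG
  set G' : ℝ → ℂ := fun t => ((P.D t : ℝ) : ℂ) with hG'
  -- square integrability on `(0,1]` (continuous, hence bounded on `[0,1]`)
  haveI : IsFiniteMeasure (volume.restrict (Ioc (0 : ℝ) 1)) :=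
    isFiniteMeasure_restrict.2 (measure_Ioc_lt_top.ne)
  have hmem : ∀ Q : ShearProfile, MemLp (fun t => ((Q t : ℝ) : ℂ)) 2 (volume.restrict (Ioc (0 : ℝ) 1)) := by
    intro Q
    obtain ⟨C, hC⟩ := isCompact_Icc.exists_bound_of_continuousOn
      ((continuous_ofReal.comp Q.continuous).continuousOn (s := Icc (0 : ℝ) 1))
    refine MemLp.of_bound (continuous_ofReal.comp Q.continuous).aestronglyMeasurable C ?_
    exact ae_restrict_of_forall_mem measurableSet_Ioc fun x hx => hC x (Ioc_subset_Icc_self hx)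
  have hP1 := hasSum_sq_fourierCoeffOn h01 (hmem P)
  have hP2 := hasSum_sq_fourierCoeffOn h01 (hmem P.D)
  -- termwise comparison of the two Parseval series
  have hterm : ∀ n : ℤ, 4 * π ^ 2 * ‖fourierCoeffOn h01 G n‖ ^ 2 ≤ ‖fourierCoeffOn h01 G' n‖ ^ 2 := by
    intro n
    rcases eq_or_ne n 0 with rfl | hn
    · have hz : fourierCoeffOn h01 G 0 = 0 := by
        rw [fourierCoeffOn_eq_integral]
        simp only [neg_zero, fourier_zero, one_smul, sub_zero, div_one, hG]
        rw [intervalIntegral.integral_ofReal, h0]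
        simp
      rw [hz, norm_zero, zero_pow two_ne_zero, mul_zero]
      positivity
    · have hderiv : ∀ x, x ∈ uIcc (0 : ℝ) 1 → HasDerivAt G (G' x) x := fun x _ => by
        have hd : HasDerivAt (P : ℝ → ℝ) (deriv P x) x :=
          ((P.contDiff.differentiable (by simp)) x).hasDerivAt
        simpa [hG, hG', ShearProfile.D_apply] using hd.ofReal_comp
      have hint : IntervalIntegrable G' volume 0 1 :=
        (continuous_ofReal.comp P.D.continuous).intervalIntegrable _ _
      have key := fourierCoeffOn_of_hasDerivAt h01 hn hderiv hint
      have hper : G 1 - G 0 = 0 := by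
        have := P.periodic 0
        simp only [zero_add] at this
        simp [hG, this]
      rw [hper, mul_zero, zero_sub] at key
      have hc : (-2 * (π : ℂ) * I * n) ≠ 0 := by
        have hπ : (π : ℂ) ≠ 0 := by exact_mod_cast Real.pi_ne_zero
        have hn' : (n : ℂ) ≠ 0 := by exact_mod_cast hn
        simp [hπ, hn', I_ne_zero]
      have key' : fourierCoeffOn h01 G' n = (2 * (π : ℂ) * I * n) * fourierCoeffOn h01 G n := by
        rw [key]
        push_cast
        field_simp
        ring
      have hnorm : ‖fourierCoeffOn h01 G' n‖ = 2 * π * |(n : ℝ)| * ‖fourierCoeffOn h01 G n‖ := by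
        rw [key', norm_mul]
        congr 1
        simp [abs_of_pos Real.pi_pos]
      have hn1 : (1 : ℝ) ≤ |(n : ℝ)| := by exact_mod_cast Int.one_le_abs hn
      rw [hnorm]
      have hsq : (1 : ℝ) ≤ |(n : ℝ)| ^ 2 := by nlinarith
      have hnn : 0 ≤ ‖fourierCoeffOn h01 G n‖ ^ 2 := by positivity
      calc 4 * π ^ 2 * ‖fourierCoeffOn h01 G n‖ ^ 2
          = (4 * π ^ 2 * ‖fourierCoeffOn h01 G n‖ ^ 2) * 1 := by ring
        _ ≤ (4 * π ^ 2 * ‖fourierCoeffOn h01 G n‖ ^ 2) * |(n : ℝ)| ^ 2 :=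
            mul_le_mul_of_nonneg_left hsq (by positivity)
        _ = (2 * π * |(n : ℝ)| * ‖fourierCoeffOn h01 G n‖) ^ 2 := by ring
  have hle := hasSum_le hterm (hP1.mul_left (4 * π ^ 2)) hP2
  -- read the two Parseval values as real profile integrals
  have e1 : ((1 : ℝ) - 0)⁻¹ • (∫ x in (0 : ℝ)..1, ‖G x‖ ^ 2) = ∫ t in (0 : ℝ)..1, P t ^ 2 := by
    simp [hG, Complex.norm_real, Real.norm_eq_abs, sq_abs]
  have e2 : ((1 : ℝ) - 0)⁻¹ • (∫ x in (0 : ℝ)..1, ‖G' x‖ ^ 2) = ∫ t in (0 : ℝ)..1, P.D t ^ 2 := by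
    simp [hG', Complex.norm_real, Real.norm_eq_abs, sq_abs]
  rw [e1] at hle
  rw [e2] at hle
  exact hle

/-- The derivative of a periodic profile has zero mean over a period. [folklore] -/
theorem integral_D_eq_zero (F : ShearProfile) : ∫ t in (0 : ℝ)..1, F.D t = 0 := by
  have h : ∫ t in (0 : ℝ)..1, deriv F t = F 1 - F 0 :=
    integral_deriv_eq_sub (fun x _ => (F.contDiff.differentiable (by simp)) x)
      ((F.contDiff.continuous_deriv (by simp)).intervalIntegrable _ _)
  simp only [ShearProfile.D_apply]
  rw [h]
  have := F.periodic 0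
  simp only [zero_add] at this
  rw [this, sub_self]

open Real in
/-- **Wirtinger for derivatives**: every smooth `1`-periodic `F` has `4π² ∫₀¹ (F′)² ≤ ∫₀¹ (F″)²`.
[folklore] -/
theorem wirtinger_D (F : ShearProfile) :
    4 * π ^ 2 * ∫ t in (0 : ℝ)..1, F.D t ^ 2 ≤ ∫ t in (0 : ℝ)..1, F.D.D t ^ 2 :=
  wirtinger F.D (integral_D_eq_zero F)

end ProfileWirtinger

end Summit.NavierStokesRegularity.FunctionalMining

end
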